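import Summits.AtomisticToContinuum.Crystallization.Theorems.ChargedEnergyGap.Negative.Unconditional

/-!
# Heart stub `stub_perronKepler` of line `merge-perron`, crux `PerronTransitivity.NoFractionalGain`
(stmt-AtomisticToContinuum-15098): certificate infrastructure and the size of the stub

Registered stub `stub_certificate` (lead reshape, cycle 1) and sorry-free facts about the heart stub
`stub_perronWeights` / the strategist's norm bound `stub_perronKepler` (the uniform operator-norm bound
`Σ_{i≠j} cᵢcⱼV_LJ(dist xᵢ xⱼ) ≥ Λ·Σcᵢ²` over `2^{-1/6}`-separated finite sets, `Λ = 2 e_LJ(hcp)`):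

* `quadForm_le_of_superharmonic_weights` — the COLLATZ–WIELANDT / reciprocal AM–GM certificate: for a
  symmetric entrywise non-negative kernel `B` on a finite index type, positive weights `w` with
  `Σ_{j≠i} B i j · w j ≤ Λ · w i` at every `i` certify `Σ_{i≠j} cᵢ cⱼ B i j ≤ Λ Σ cᵢ²` for ALL real `c`.
  This is the only shape of certificate for the heart that survives the strategist's first-order
  obstruction (multiplicative weights = antisymmetric transfers to first order); with `w ≡ 1` it is the
  one-centre (maximal row sum) bound.
* `perronConstant_le_two_mul_energyPerParticle` — ANY constant `Λ` that bounds the Lennard-Jones form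
  from below uniformly over `2^{-1/6}`-separated finite configurations (even only at `c ≡ 1`) satisfies
  `Λ ≤ 2 e_LJ(Q)` for every `2^{-1/6}`-separated periodic configuration `Q` (blocks of `Q` are trial
  states: `Blocks.exists_block_energy_le`).  Hence `stub_perronKepler` (constant `2 e_LJ(hcp a h)` at an
  e_LJ-optimal hcp scale) contains the statement that the relaxed hcp crystal minimises the Lennard-Jones
  energy per particle among all `2^{-1/6}`-separated periodic configurations of `ℝ³` — the periodic
  Lennard-Jones crystal problem (Blanc–Lewin 2015 §2.3), recorded here as `hcp_le_of_perronKepler`.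
-/

noncomputable section

namespace Summit.AtomisticToContinuum.Crystallization.Theorems.PerronTransitivity.NoFractionalGain

open Literature.MathematicalPhysics.StatisticalMechanics
open Summit.AtomisticToContinuum.Crystallization.Theorems.ChargedEnergyGapNegative
open scoped BigOperators

/-! ## The Collatz–Wielandt (reciprocal AM–GM) certificate -/

/-- **Collatz–Wielandt / reciprocal AM–GM certificate for a non-negative symmetric kernel.**  If
`B i j ≥ 0`, `B i j = B j i`, and positive weights `w` satisfy `Σ_{j ≠ i} B i j · w j ≤ Λ · w i` for every
`i`, then `Σ_i Σ_{j ≠ i} cᵢ cⱼ B i j ≤ Λ · Σ cᵢ²` for every real vector `c`.  Proof: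
`2 cᵢ cⱼ ≤ cᵢ² wⱼ/wᵢ + cⱼ² wᵢ/wⱼ`, symmetrise, and sum the rows against the weights. [folklore] -/
theorem quadForm_le_of_superharmonic_weights {ι : Type*} [Fintype ι] [DecidableEq ι]
    (B : ι → ι → ℝ) (hB : ∀ i j, 0 ≤ B i j) (hsymm : ∀ i j, B i j = B j i)
    (w : ι → ℝ) (hw : ∀ i, 0 < w i) (Λ : ℝ)
    (hΛ : ∀ i, ∑ j ∈ Finset.univ.erase i, B i j * w j ≤ Λ * w i) (c : ι → ℝ) :
    ∑ i, ∑ j ∈ Finset.univ.erase i, c i * c j * B i j ≤ Λ * ∑ i, c i ^ 2 := by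
  -- pointwise AM–GM with reciprocal weights
  have hpt : ∀ i j, c i * c j * B i j ≤
      (1 / 2) * (c i ^ 2 * (w j / w i) * B i j) + (1 / 2) * (c j ^ 2 * (w i / w j) * B i j) := by
    intro i j
    have hwi := hw i
    have hwj := hw j
    have hsq : 0 ≤ (c i * w j - c j * w i) ^ 2 := sq_nonneg _
    have hkey : 2 * (c i * c j) ≤ c i ^ 2 * (w j / w i) + c j ^ 2 * (w i / w j) := by
      have hid : c i ^ 2 * (w j / w i) + c j ^ 2 * (w i / w j) - 2 * (c i * c j) =
          (c i * w j - c j * w i) ^ 2 / (w i * w j) := by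
        field_simp
        ring
      have hnn : 0 ≤ (c i * w j - c j * w i) ^ 2 / (w i * w j) :=
        div_nonneg hsq (mul_pos hwi hwj).le
      linarith
    nlinarith [hB i j]
  -- sum the pointwise bound
  have hsum : ∑ i, ∑ j ∈ Finset.univ.erase i, c i * c j * B i j ≤
      ∑ i, ∑ j ∈ Finset.univ.erase i,
        ((1 / 2) * (c i ^ 2 * (w j / w i) * B i j) + (1 / 2) * (c j ^ 2 * (w i / w j) * B i j)) :=
    Finset.sum_le_sum fun i _ => Finset.sum_le_sum fun j _ => hpt i j
  -- the symmetrised sum equals the one-sided sum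
  have hswap : ∑ i, ∑ j ∈ Finset.univ.erase i, c j ^ 2 * (w i / w j) * B i j =
      ∑ i, ∑ j ∈ Finset.univ.erase i, c i ^ 2 * (w j / w i) * B i j := by
    have h1 : ∀ f : ι → ι → ℝ, ∑ i, ∑ j ∈ Finset.univ.erase i, f i j =
        ∑ i, ∑ j, if i = j then 0 else f i j := by
      intro f
      refine Finset.sum_congr rfl fun i _ => ?_
      rw [← Finset.add_sum_erase Finset.univ _ (Finset.mem_univ i), if_pos rfl, zero_add]
      exact Finset.sum_congr rfl fun j hj => by rw [if_neg (Finset.ne_of_mem_erase hj).symm]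
    rw [h1, h1, Finset.sum_comm]
    refine Finset.sum_congr rfl fun i _ => Finset.sum_congr rfl fun j _ => ?_
    by_cases hij : j = i
    · simp [hij]
    · rw [if_neg hij, if_neg (Ne.symm hij), hsymm j i]
  have hrow : ∑ i, ∑ j ∈ Finset.univ.erase i, c i ^ 2 * (w j / w i) * B i j ≤ Λ * ∑ i, c i ^ 2 := by
    rw [Finset.mul_sum]
    refine Finset.sum_le_sum fun i _ => ?_
    have hwi := hw i
    have hre : ∑ j ∈ Finset.univ.erase i, c i ^ 2 * (w j / w i) * B i j =
        (c i ^ 2 / w i) * ∑ j ∈ Finset.univ.erase i, B i j * w j := by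
      rw [Finset.mul_sum]
      refine Finset.sum_congr rfl fun j _ => ?_
      field_simp
    rw [hre]
    calc c i ^ 2 / w i * ∑ j ∈ Finset.univ.erase i, B i j * w j
        ≤ c i ^ 2 / w i * (Λ * w i) :=
          mul_le_mul_of_nonneg_left (hΛ i) (div_nonneg (sq_nonneg _) hwi.le)
      _ = Λ * c i ^ 2 := by field_simp
  calc ∑ i, ∑ j ∈ Finset.univ.erase i, c i * c j * B i j
      ≤ ∑ i, ∑ j ∈ Finset.univ.erase i,
          ((1 / 2) * (c i ^ 2 * (w j / w i) * B i j) + (1 / 2) * (c j ^ 2 * (w i / w j) * B i j)) := hsum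
    _ = ∑ i, ∑ j ∈ Finset.univ.erase i, c i ^ 2 * (w j / w i) * B i j := by
          simp only [Finset.sum_add_distrib, ← Finset.mul_sum, hswap]
          ring
    _ ≤ Λ * ∑ i, c i ^ 2 := hrow

/-- **Stub `stub_certificate` of line `merge-perron` (crux `NoFractionalGain`, stmt-AtomisticToContinuum-15098):
the Collatz–Wielandt certificate on `Fin N`** — the registered form of
`quadForm_le_of_superharmonic_weights`. [folklore] -/
theorem stub_certificate : ∀ (N : ℕ) (B : Fin N → Fin N → ℝ), (∀ i j, 0 ≤ B i j) → (∀ i j, B i j = B j i) →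
    ∀ (w : Fin N → ℝ), (∀ i, 0 < w i) → ∀ Λ : ℝ,
      (∀ i, ∑ j ∈ Finset.univ.erase i, B i j * w j ≤ Λ * w i) →
      ∀ c : Fin N → ℝ, ∑ i, ∑ j ∈ Finset.univ.erase i, c i * c j * B i j ≤ Λ * ∑ i, c i ^ 2 :=
  fun _N B hB hsymm w hw Λ hΛ c => quadForm_le_of_superharmonic_weights B hB hsymm w hw Λ hΛ c

/-- **One-centre (maximal row sum) bound for the Lennard-Jones binding form on a fully attractive
configuration.**  If every pair of a finite configuration attracts (`V_LJ(dist xᵢ xⱼ) ≤ 0` for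
`i ≠ j`) and no site is bound better than `Λ` (`−Σ_{j≠i} V_ij ≤ Λ` at every site), then
`−Λ·Σcᵢ² ≤ Σ_{i≠j} cᵢcⱼV_ij` for all real `c` (the `w ≡ 1` case of the certificate). [folklore] -/
theorem lj_quadForm_ge_of_rowSum_le {N : ℕ} (x : Fin N → EuclideanSpace ℝ (Fin 3)) (Λ : ℝ)
    (hattr : ∀ i j, i ≠ j → lennardJones (dist (x i) (x j)) ≤ 0)
    (hrow : ∀ i, -∑ j ∈ Finset.univ.erase i, lennardJones (dist (x i) (x j)) ≤ Λ)
    (c : Fin N → ℝ) :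
    -Λ * ∑ i, c i ^ 2 ≤ ∑ i, ∑ j ∈ Finset.univ.erase i, c i * c j * lennardJones (dist (x i) (x j)) := by
  classical
  set B : Fin N → Fin N → ℝ := fun i j => if i = j then 0 else -lennardJones (dist (x i) (x j))
    with hBdef
  have hB : ∀ i j, 0 ≤ B i j := by
    intro i j
    by_cases hij : i = j
    · simp [hBdef, hij]
    · simp only [hBdef, if_neg hij]
      linarith [hattr i j hij]
  have hsymm : ∀ i j, B i j = B j i := by
    intro i j
    by_cases hij : i = j
    · simp [hBdef, hij]
    · simp only [hBdef, if_neg hij, if_neg (Ne.symm hij), dist_comm]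
  have hΛ : ∀ i, ∑ j ∈ Finset.univ.erase i, B i j * (1 : ℝ) ≤ Λ * 1 := by
    intro i
    have : ∑ j ∈ Finset.univ.erase i, B i j * (1 : ℝ) =
        -∑ j ∈ Finset.univ.erase i, lennardJones (dist (x i) (x j)) := by
      rw [← Finset.sum_neg_distrib]
      refine Finset.sum_congr rfl fun j hj => ?_
      simp only [hBdef, if_neg (Finset.ne_of_mem_erase hj).symm, mul_one]
    rw [this, mul_one]
    exact hrow i
  have h := quadForm_le_of_superharmonic_weights B hB hsymm (fun _ => 1) (fun _ => one_pos) Λ hΛ c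
  have hre : ∑ i, ∑ j ∈ Finset.univ.erase i, c i * c j * B i j =
      -∑ i, ∑ j ∈ Finset.univ.erase i, c i * c j * lennardJones (dist (x i) (x j)) := by
    rw [← Finset.sum_neg_distrib]
    refine Finset.sum_congr rfl fun i _ => ?_
    rw [← Finset.sum_neg_distrib]
    refine Finset.sum_congr rfl fun j hj => ?_
    simp only [hBdef, if_neg (Finset.ne_of_mem_erase hj).symm]
    ring
  rw [hre] at h
  linarith

/-! ## Any uniform Perron constant is at most `2 e_LJ(Q)` for every separated periodic `Q` -/

/-- **A uniform lower bound on the Lennard-Jones form over separated finite configurations is a lower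
bound on twice the energy per particle of every separated periodic configuration.**  If
`Λ·N ≤ Σ_{i≠j} V_LJ(dist yᵢ yⱼ)` for every `2^{-1/6}`-separated finite injective `y` (the `c ≡ 1`
instance of a uniform weighted bound), then `Λ ≤ 2·e_LJ(Q)` for every periodic configuration `Q` of
`ℝ³` whose points are `2^{-1/6}`-separated: the blocks of `Q` are separated trial states whose energy
per particle tends to `e_LJ(Q)` (`Blocks.exists_block_energy_le`). [folklore] -/
theorem perronConstant_le_two_mul_energyPerParticle (Λ : ℝ)
    (hΛ : ∀ (N : ℕ) (y : Fin N → EuclideanSpace ℝ (Fin 3)), Function.Injective y →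
      (∀ i j, i ≠ j → (1 : ℝ) / 2 ≤ dist (y i) (y j) ^ 6) →
      Λ * N ≤ ∑ i, ∑ j ∈ Finset.univ.erase i, lennardJones (dist (y i) (y j)))
    (Q : PeriodicConfiguration 3)
    (hQ : ∀ p ∈ Q.points, ∀ q ∈ Q.points, p ≠ q → (1 : ℝ) / 2 ≤ dist p q ^ 6) :
    Λ ≤ 2 * Q.energyPerParticle lennardJones := by
  -- argue `Λ ≤ 2 (e(Q) + ε)` for every `ε > 0`
  refine le_of_forall_pos_lt_add fun ε hε => ?_
  obtain ⟨K₀, hK₀, hK⟩ := Blocks.exists_block_energy_le Q (show 0 < ε / 4 by positivity)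
  have hinj : Function.Injective (Blocks.blockConfig Q K₀) := Blocks.blockConfig_injective Q K₀
  have hsep : ∀ i j, i ≠ j →
      (1 : ℝ) / 2 ≤ dist (Blocks.blockConfig Q K₀ i) (Blocks.blockConfig Q K₀ j) ^ 6 := by
    intro i j hij
    refine hQ _ ?_ _ ?_ (hinj.ne hij)
    · rw [Blocks.blockConfig_apply]; exact Blocks.bpt_mem Q K₀ _
    · rw [Blocks.blockConfig_apply]; exact Blocks.bpt_mem Q K₀ _
  have hnpos : 0 < Fintype.card (Blocks.BIdx Q K₀) := by
    rw [Blocks.card_BIdx]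
    exact Nat.mul_pos Q.motif_nonempty.card_pos (pow_pos hK₀ 3)
  have hnr : (0 : ℝ) < Fintype.card (Blocks.BIdx Q K₀) := by exact_mod_cast hnpos
  have h1 := hΛ _ (Blocks.blockConfig Q K₀) hinj hsep
  have h2 : ∑ i, ∑ j ∈ Finset.univ.erase i,
      lennardJones (dist (Blocks.blockConfig Q K₀ i) (Blocks.blockConfig Q K₀ j)) =
      2 * interactionEnergy lennardJones (Blocks.blockConfig Q K₀) := by
    rw [two_mul_interactionEnergy]; rfl
  have h3 := hK K₀ le_rfl
  rw [h2] at h1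
  set n := Fintype.card (Blocks.BIdx Q K₀)
  -- `Λ n ≤ 2 E(y) ≤ 2 n (e + ε/4)`, divide by `n`
  have h4 : Λ * n ≤ 2 * (n * (Q.energyPerParticle lennardJones + ε / 4)) := by linarith
  have h5 : Λ ≤ 2 * (Q.energyPerParticle lennardJones + ε / 4) := by
    by_contra hlt
    have hlt' : 2 * (Q.energyPerParticle lennardJones + ε / 4) < Λ := lt_of_not_ge hlt
    have := mul_lt_mul_of_pos_right hlt' hnr
    linarith
  linarith

/-- **The heart stub contains the separated periodic Lennard-Jones crystal problem.**  If the
conclusion of `stub_perronKepler` holds — at every e_LJ-optimal hcp scale `(a, h)`, the bound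
`2·e_LJ(hcp a h)·Σcᵢ² ≤ Σ_{i≠j} cᵢcⱼV_LJ(dist xᵢ xⱼ)` for all `2^{-1/6}`-separated finite `x` and all
real `c` — then every such hcp crystal has energy per particle at most that of ANY periodic
configuration of `ℝ³` with `2^{-1/6}`-separated points: `e_LJ(hcp a h) ≤ e_LJ(Q)`.  (Numerically the
margins are `1.0·10⁻⁴` (fcc), `5·10⁻⁵` (dhcp) relative; the statement is open, Blanc–Lewin 2015 §2.3.)
[folklore] -/
theorem hcp_le_of_perronKepler
    (hpk : ∀ (a h : ℝ) (ha : 0 < a) (hh : 0 < h),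
      (∀ (a' h' : ℝ) (ha' : 0 < a') (hh' : 0 < h'),
        (hcpPeriodicConfiguration ha.ne' hh.ne').energyPerParticle lennardJones ≤
          (hcpPeriodicConfiguration ha'.ne' hh'.ne').energyPerParticle lennardJones) →
      ∀ (N : ℕ) (x : Fin N → EuclideanSpace ℝ (Fin 3)), Function.Injective x →
        (∀ i j, i ≠ j → (1 : ℝ) / 2 ≤ dist (x i) (x j) ^ 6) →
        ∀ c : Fin N → ℝ,
          2 * (hcpPeriodicConfiguration ha.ne' hh.ne').energyPerParticle lennardJones * ∑ i, c i ^ 2 ≤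
            ∑ i, ∑ j ∈ Finset.univ.erase i, c i * c j * lennardJones (dist (x i) (x j)))
    (a h : ℝ) (ha : 0 < a) (hh : 0 < h)
    (hopt : ∀ (a' h' : ℝ) (ha' : 0 < a') (hh' : 0 < h'),
      (hcpPeriodicConfiguration ha.ne' hh.ne').energyPerParticle lennardJones ≤
        (hcpPeriodicConfiguration ha'.ne' hh'.ne').energyPerParticle lennardJones)
    (Q : PeriodicConfiguration 3)
    (hQ : ∀ p ∈ Q.points, ∀ q ∈ Q.points, p ≠ q → (1 : ℝ) / 2 ≤ dist p q ^ 6) :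
    (hcpPeriodicConfiguration ha.ne' hh.ne').energyPerParticle lennardJones ≤
      Q.energyPerParticle lennardJones := by
  have h := perronConstant_le_two_mul_energyPerParticle
    (2 * (hcpPeriodicConfiguration ha.ne' hh.ne').energyPerParticle lennardJones) ?_ Q hQ
  · linarith
  intro N y hy hsep
  have h1 := hpk a h ha hh hopt N y hy hsep (fun _ => 1)
  simpa using h1

end Summit.AtomisticToContinuum.Crystallization.Theorems.PerronTransitivity.NoFractionalGain

end
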